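import Mathlib
import Summits.Ventures.PercRepro2.OneTypedEdge

/-!
# The typed (SEP-3) zero, I: the glued states and the double symmetrisation (blind cell
PercRepro2, p3 g6, 2026-08-25; `proofs/P3-BRIDGE.md` §11.20, `proofs/LEAD-SEP3.md` §1)

When `{a₁, a₃}` separates `o` from `a₂` and from `b`, a copy's state `(q', Lo, Ho, Lb, Hb, L3, H3)`
is a function of its o-side partition state `(α, β, X)` (`o ~ a₁`, `o ~ a₃`, `a₁ ~ a₃` inside the
o-side) and its b-side partition state `(h₁₂, h₃₂, Y, b₁, b₂, b₃)` (the connections among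
`a₁, a₂, a₃, b` inside the b-side): `glued`.  The typed count of an instance is
`Σ cnt_o(s) · cnt_b(t) · KB(glued s₁ t₁, glued s₂ t₂, glued s₃ t₃)` over ORDERED state triples,
and since each side's count is invariant under permuting the copies, the kernel may be
symmetrised over the o-copies and the b-copies INDEPENDENTLY (`dsym`, 36 terms).  THE POINT:
`dsym` VANISHES IDENTICALLY on valid states (`dsym_eq_zero`), by `decide` on the sorted
representatives — although neither one-sided symmetrisation does.

THE MECHANISM, for NEG-150 («a further class theorem needs a NON-POINTWISE mechanism — an
identity …, an induction …, or an injection between state triples»): `dsym x y w u v r` is the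
36-term sum `Σ_{σ, σ′ ∈ S₃} KB (glued x_σ u_σ′) (glued y_σ v_σ′) (glued w_σ r_σ′)` — the o-copies
and the b-copies permuted INDEPENDENTLY (the group `S₃ × S₃`), not the 6-fold diagonal
symmetrisation of the pointwise-on-states method; it is a legitimate kernel by the IDENTITY
`36 · typedCount (sideKernel Φ) = typedCount (sideKernel (symB (symA Φ)))`
(`TypedSepThreeSym.lean`), applied before the pointwise `decide`.  Own work; standard axioms.
-/

namespace Summit.Ventures.PercRepro2

namespace CovForm

namespace SepThree

open OneTyped

/-! ## The side states and the gluing -/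

/-- The o-side state `(α, β, X)`: `o ~ a₁`, `o ~ a₃`, `a₁ ~ a₃` inside the o-side. -/
abbrev OSt := Bool × Bool × Bool

/-- The b-side state `(h₁₂, h₃₂, Y, b₁, b₂, b₃)`: `a₁ ~ a₂`, `a₃ ~ a₂`, `a₁ ~ a₃`, `b ~ a₁`,
`b ~ a₂`, `b ~ a₃` inside the b-side. -/
abbrev BSt := Bool × Bool × Bool × Bool × Bool × Bool

/-- An o-side state is valid when it is a set partition of `{o, a₁, a₃}` (transitivity). -/
def ValidO (s : OSt) : Bool :=
  (!(s.1 && s.2.1) || s.2.2) && (!(s.1 && s.2.2) || s.2.1) && (!(s.2.1 && s.2.2) || s.1)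

/-- Transitivity on one triangle of points. -/
def tri (a b c : Bool) : Bool := (!(a && b) || c) && (!(a && c) || b) && (!(b && c) || a)

/-- A b-side state is valid when it is a set partition of `{a₁, a₂, a₃, b}` (the four
triangles). -/
def ValidB (t : BSt) : Bool :=
  tri t.1 t.2.1 t.2.2.1 && tri t.1 t.2.2.2.1 t.2.2.2.2.1 && tri t.2.2.1 t.2.2.2.1 t.2.2.2.2.2 &&
    tri t.2.1 t.2.2.2.2.1 t.2.2.2.2.2

/-- **The glued state** of a copy from its two side states: `a₁~a₂ = h₁₂ ∨ (X ∧ h₃₂)`,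
`a₃~a₂ = h₃₂ ∨ (X ∧ h₁₂)`, `a₁~a₃ = X ∨ Y`, `o~a₁ = α ∨ (β ∧ (X ∨ Y))`,
`o~a₂ = (α ∧ a₁~a₂) ∨ (β ∧ a₃~a₂)`, `b~a₁ = b₁ ∨ (b₃ ∧ (X ∨ Y))`,
`b~a₂ = b₂ ∨ (b₁ ∧ a₁~a₂) ∨ (b₃ ∧ a₃~a₂)`. -/
def glued (s : OSt) (t : BSt) : St :=
  let al := s.1
  let be := s.2.1
  let X := s.2.2
  let h12 := t.1
  let h32 := t.2.1
  let Y := t.2.2.1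
  let b1 := t.2.2.2.1
  let b2 := t.2.2.2.2.1
  let b3 := t.2.2.2.2.2
  let a13 := X || Y
  let qp := h12 || (X && h32)
  let a32 := h32 || (X && h12)
  (qp, al || (be && a13), (al && qp) || (be && a32), b1 || (b3 && a13),
    b2 || (b1 && qp) || (b3 && a32), a13, a32)

/-- The kernel on glued state triples. -/
def psi (x y w : OSt) (u v r : BSt) : ℤ := KB (glued x u) (glued y v) (glued w r)

/-- **The doubly symmetrised kernel**: the sum over the six orderings of the o-states and,
independently, the six orderings of the b-states (36 terms). -/
def dsym (x y w : OSt) (u v r : BSt) : ℤ :=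
  (psi x y w u v r + psi x y w u r v + psi x y w v u r + psi x y w v r u + psi x y w r u v +
      psi x y w r v u) +
  (psi x w y u v r + psi x w y u r v + psi x w y v u r + psi x w y v r u + psi x w y r u v +
      psi x w y r v u) +
  (psi y x w u v r + psi y x w u r v + psi y x w v u r + psi y x w v r u + psi y x w r u v +
      psi y x w r v u) +
  (psi y w x u v r + psi y w x u r v + psi y w x v u r + psi y w x v r u + psi y w x r u v +
      psi y w x r v u) +
  (psi w x y u v r + psi w x y u r v + psi w x y v u r + psi w x y v r u + psi w x y r u v +
      psi w x y r v u) +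
  (psi w y x u v r + psi w y x u r v + psi w y x v u r + psi w y x v r u + psi w y x r u v +
      psi w y x r v u)

/-! ## Invariance of `dsym` under the copy permutations of either side -/

/-- `dsym` is symmetric in the first two o-states. -/
lemma dsym_swapO12 (x y w : OSt) (u v r : BSt) : dsym x y w u v r = dsym y x w u v r := by
  unfold dsym; ring

/-- `dsym` is symmetric in the last two o-states. -/
lemma dsym_swapO23 (x y w : OSt) (u v r : BSt) : dsym x y w u v r = dsym x w y u v r := by
  unfold dsym; ring

/-- `dsym` is symmetric in the first two b-states. -/
lemma dsym_swapB12 (x y w : OSt) (u v r : BSt) : dsym x y w u v r = dsym x y w v u r := by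
  unfold dsym; ring

/-- `dsym` is symmetric in the last two b-states. -/
lemma dsym_swapB23 (x y w : OSt) (u v r : BSt) : dsym x y w u v r = dsym x y w u r v := by
  unfold dsym; ring

/-! ## The valid states -/

/-- The five valid o-side states. -/
def oList : List OSt := [(false, false, false),
    (false, false, true),
    (false, true, false),
    (true, false, false),
    (true, true, true)]

/-- The fifteen valid b-side states. -/
def bList : List BSt :=
  [(false, false, false, false, false, false), (false, false, false, false, false, true),
   (false, false, false, false, true, false), (false, false, false, true, false, false),
   (false, false, true, false, false, false), (false, false, true, false, true, false),
   (false, false, true, true, false, true), (false, true, false, false, false, false),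
   (false, true, false, false, true, true), (false, true, false, true, false, false),
   (true, false, false, false, false, false), (true, false, false, false, false, true),
   (true, false, false, true, true, false), (true, true, true, false, false, false),
   (true, true, true, true, true, true)]

/-- Every valid o-side state is one of the five. -/
theorem mem_oList (s : OSt) (h : ValidO s = true) : s ∈ oList := by
  revert s; decide

/-- Every valid b-side state is one of the fifteen. -/
theorem mem_bList (t : BSt) (h : ValidB t = true) : t ∈ bList := by
  revert t; decide

/-- A numeric code of an o-side state (for sorting). -/
def codeO (s : OSt) : ℕ := s.1.toNat * 4 + s.2.1.toNat * 2 + s.2.2.toNat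

/-- A numeric code of a b-side state (for sorting). -/
def codeB (t : BSt) : ℕ :=
  t.1.toNat * 32 + t.2.1.toNat * 16 + t.2.2.1.toNat * 8 + t.2.2.2.1.toNat * 4 +
    t.2.2.2.2.1.toNat * 2 + t.2.2.2.2.2.toNat

/-- The sorted valid o-triples (35). -/
def oTriples : List (OSt × OSt × OSt) :=
  (oList.flatMap fun x => oList.flatMap fun y => oList.map fun w => (x, y, w)).filter
    fun s => decide (codeO s.1 ≤ codeO s.2.1 ∧ codeO s.2.1 ≤ codeO s.2.2)

/-- The sorted valid b-triples (680). -/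
def bTriples : List (BSt × BSt × BSt) :=
  (bList.flatMap fun u => bList.flatMap fun v => bList.map fun r => (u, v, r)).filter
    fun t => decide (codeB t.1 ≤ codeB t.2.1 ∧ codeB t.2.1 ≤ codeB t.2.2)

/-- Membership in the sorted o-triples. -/
lemma mem_oTriples {x y w : OSt} :
    (x, y, w) ∈ oTriples ↔
      (x ∈ oList ∧ y ∈ oList ∧ w ∈ oList) ∧ (codeO x ≤ codeO y ∧ codeO y ≤ codeO w) := by
  simp only [oTriples, List.mem_filter, List.mem_flatMap, List.mem_map, decide_eq_true_eq,
    Prod.mk.injEq]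
  constructor
  · rintro ⟨⟨x', hx', y', hy', w', hw', rfl, rfl, rfl⟩, h⟩
    exact ⟨⟨hx', hy', hw'⟩, h⟩
  · rintro ⟨⟨hx, hy, hw⟩, h⟩
    exact ⟨⟨x, hx, y, hy, w, hw, rfl, rfl, rfl⟩, h⟩

/-- Membership in the sorted b-triples. -/
lemma mem_bTriples {u v r : BSt} :
    (u, v, r) ∈ bTriples ↔
      (u ∈ bList ∧ v ∈ bList ∧ r ∈ bList) ∧ (codeB u ≤ codeB v ∧ codeB v ≤ codeB r) := by
  simp only [bTriples, List.mem_filter, List.mem_flatMap, List.mem_map, decide_eq_true_eq,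
    Prod.mk.injEq]
  constructor
  · rintro ⟨⟨u', hu', v', hv', r', hr', rfl, rfl, rfl⟩, h⟩
    exact ⟨⟨hu', hv', hr'⟩, h⟩
  · rintro ⟨⟨hu, hv, hr⟩, h⟩
    exact ⟨⟨u, hu, v, hv, r, hr, rfl, rfl, rfl⟩, h⟩

/-! ## The vanishing on the sorted representatives -/


/-- The o-states at or above `y` in the code order. -/
def oSorted (y : OSt) : List OSt := oList.filter fun w => decide (codeO y ≤ codeO w)

/-- The b-states at or above `u` in the code order. -/
def bSorted (u : BSt) : List BSt := bList.filter fun v => decide (codeB u ≤ codeB v)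

/-- A conjunction of three Boolean facts. -/
lemma and3 {a b c : Bool} (h : (a && b && c) = true) : a = true ∧ b = true ∧ c = true := by
  simp only [Bool.and_eq_true] at h
  exact ⟨h.1.1, h.1.2, h.2⟩

/-- The vanishing for a fixed sorted o-triple `x ≤ y ≤ w`, as a Boolean computation over the sorted
b-triples (`u ≤ v ≤ r`). -/
def allZeroAt (x y w : OSt) : Bool :=
  bList.all fun u => (bSorted u).all fun v => (bSorted v).all fun r =>
    decide (dsym x y w u v r = 0)

/-- Slice 0: three sorted o-triples. -/
theorem allZeroAt_0 :
    (allZeroAt (false, false, false) (false, false, false) (false, false, false) &&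
      allZeroAt (false, false, false) (false, false, false) (false, false, true) &&
      allZeroAt (false, false, false) (false, false, false) (false, true, false)) = true := by
  decide +kernel
/-- Slice 1: three sorted o-triples. -/
theorem allZeroAt_1 :
    (allZeroAt (false, false, false) (false, false, false) (true, false, false) &&
      allZeroAt (false, false, false) (false, false, false) (true, true, true) &&
      allZeroAt (false, false, false) (false, false, true) (false, false, true)) = true := by
  decide +kernel
/-- Slice 2: three sorted o-triples. -/
theorem allZeroAt_2 :
    (allZeroAt (false, false, false) (false, false, true) (false, true, false) &&
      allZeroAt (false, false, false) (false, false, true) (true, false, false) &&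
      allZeroAt (false, false, false) (false, false, true) (true, true, true)) = true := by
  decide +kernel
/-- Slice 3: three sorted o-triples. -/
theorem allZeroAt_3 :
    (allZeroAt (false, false, false) (false, true, false) (false, true, false) &&
      allZeroAt (false, false, false) (false, true, false) (true, false, false) &&
      allZeroAt (false, false, false) (false, true, false) (true, true, true)) = true := by
  decide +kernel
/-- Slice 4: three sorted o-triples. -/
theorem allZeroAt_4 :
    (allZeroAt (false, false, false) (true, false, false) (true, false, false) &&
      allZeroAt (false, false, false) (true, false, false) (true, true, true) &&
      allZeroAt (false, false, false) (true, true, true) (true, true, true)) = true := by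
  decide +kernel
/-- Slice 5: three sorted o-triples. -/
theorem allZeroAt_5 :
    (allZeroAt (false, false, true) (false, false, true) (false, false, true) &&
      allZeroAt (false, false, true) (false, false, true) (false, true, false) &&
      allZeroAt (false, false, true) (false, false, true) (true, false, false)) = true := by
  decide +kernel
/-- Slice 6: three sorted o-triples. -/
theorem allZeroAt_6 :
    (allZeroAt (false, false, true) (false, false, true) (true, true, true) &&
      allZeroAt (false, false, true) (false, true, false) (false, true, false) &&
      allZeroAt (false, false, true) (false, true, false) (true, false, false)) = true := by
  decide +kernel
/-- Slice 7: three sorted o-triples. -/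
theorem allZeroAt_7 :
    (allZeroAt (false, false, true) (false, true, false) (true, true, true) &&
      allZeroAt (false, false, true) (true, false, false) (true, false, false) &&
      allZeroAt (false, false, true) (true, false, false) (true, true, true)) = true := by
  decide +kernel
/-- Slice 8: three sorted o-triples. -/
theorem allZeroAt_8 :
    (allZeroAt (false, false, true) (true, true, true) (true, true, true) &&
      allZeroAt (false, true, false) (false, true, false) (false, true, false) &&
      allZeroAt (false, true, false) (false, true, false) (true, false, false)) = true := by
  decide +kernel
/-- Slice 9: three sorted o-triples. -/
theorem allZeroAt_9 :
    (allZeroAt (false, true, false) (false, true, false) (true, true, true) &&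
      allZeroAt (false, true, false) (true, false, false) (true, false, false) &&
      allZeroAt (false, true, false) (true, false, false) (true, true, true)) = true := by
  decide +kernel
/-- Slice 10: three sorted o-triples. -/
theorem allZeroAt_10 :
    (allZeroAt (false, true, false) (true, true, true) (true, true, true) &&
      allZeroAt (true, false, false) (true, false, false) (true, false, false) &&
      allZeroAt (true, false, false) (true, false, false) (true, true, true)) = true := by
  decide +kernel
/-- Slice 11: three sorted o-triples. -/
theorem allZeroAt_11 :
    (allZeroAt (true, false, false) (true, true, true) (true, true, true) &&
      allZeroAt (true, true, true) (true, true, true) (true, true, true)) = true := by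
  decide +kernel

/-- The sorted o-triples, listed. -/
theorem oTriples_eq : oTriples =
    [((false, false, false), (false, false, false), (false, false, false)),
    ((false, false, false), (false, false, false), (false, false, true)),
    ((false, false, false), (false, false, false), (false, true, false)),
    ((false, false, false), (false, false, false), (true, false, false)),
    ((false, false, false), (false, false, false), (true, true, true)),
    ((false, false, false), (false, false, true), (false, false, true)),
    ((false, false, false), (false, false, true), (false, true, false)),
    ((false, false, false), (false, false, true), (true, false, false)),
    ((false, false, false), (false, false, true), (true, true, true)),
    ((false, false, false), (false, true, false), (false, true, false)),
    ((false, false, false), (false, true, false), (true, false, false)),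
    ((false, false, false), (false, true, false), (true, true, true)),
    ((false, false, false), (true, false, false), (true, false, false)),
    ((false, false, false), (true, false, false), (true, true, true)),
    ((false, false, false), (true, true, true), (true, true, true)),
    ((false, false, true), (false, false, true), (false, false, true)),
    ((false, false, true), (false, false, true), (false, true, false)),
    ((false, false, true), (false, false, true), (true, false, false)),
    ((false, false, true), (false, false, true), (true, true, true)),
    ((false, false, true), (false, true, false), (false, true, false)),
    ((false, false, true), (false, true, false), (true, false, false)),
    ((false, false, true), (false, true, false), (true, true, true)),
    ((false, false, true), (true, false, false), (true, false, false)),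
    ((false, false, true), (true, false, false), (true, true, true)),
    ((false, false, true), (true, true, true), (true, true, true)),
    ((false, true, false), (false, true, false), (false, true, false)),
    ((false, true, false), (false, true, false), (true, false, false)),
    ((false, true, false), (false, true, false), (true, true, true)),
    ((false, true, false), (true, false, false), (true, false, false)),
    ((false, true, false), (true, false, false), (true, true, true)),
    ((false, true, false), (true, true, true), (true, true, true)),
    ((true, false, false), (true, false, false), (true, false, false)),
    ((true, false, false), (true, false, false), (true, true, true)),
    ((true, false, false), (true, true, true), (true, true, true)),
    ((true, true, true), (true, true, true), (true, true, true))] := by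
  decide

/-- The vanishing on the sorted representatives as a Boolean computation (the 23,800 sorted pairs
of valid triples, 36 kernel terms each, in 35 slices by the sorted o-triple). -/
theorem dsym_zero_all : (oTriples.all fun s => allZeroAt s.1 s.2.1 s.2.2) = true := by
  rw [oTriples_eq]
  simp only [List.all_cons, List.all_nil, Bool.and_true, Bool.and_eq_true]
  have h0 := and3 allZeroAt_0
  have h1 := and3 allZeroAt_1
  have h2 := and3 allZeroAt_2
  have h3 := and3 allZeroAt_3
  have h4 := and3 allZeroAt_4
  have h5 := and3 allZeroAt_5
  have h6 := and3 allZeroAt_6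
  have h7 := and3 allZeroAt_7
  have h8 := and3 allZeroAt_8
  have h9 := and3 allZeroAt_9
  have h10 := and3 allZeroAt_10
  have h11 := (Bool.and_eq_true _ _).mp allZeroAt_11
  exact ⟨h0.1, h0.2.1, h0.2.2, h1.1, h1.2.1, h1.2.2, h2.1, h2.2.1, h2.2.2,
    h3.1, h3.2.1, h3.2.2, h4.1, h4.2.1, h4.2.2, h5.1, h5.2.1, h5.2.2,
    h6.1, h6.2.1, h6.2.2, h7.1, h7.2.1, h7.2.2, h8.1, h8.2.1, h8.2.2,
    h9.1, h9.2.1, h9.2.2, h10.1, h10.2.1, h10.2.2, h11.1, h11.2⟩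

end SepThree

end CovForm

end Summit.Ventures.PercRepro2
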